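/- Copyright: the b2b-balaban cell (near-miss cell 7), T⁴-continuum fan-out, row NE7b owner lineage
`b2b-balaban-t4-ne7b-p1` (gen 23), node U5c COUNT member.  Released under the licence of the surrounding project. -/
import Summits.QuantumFields.BalabanUV.T4Continuum.Support.HistoryRealiseCellsRunPinned
import Summits.QuantumFields.BalabanUV.T4Continuum.Support.HistoryHybridRescale
import Literature.MathematicalPhysics.QuantumFieldTheory.Balaban1983to89.T4ApexHybrid

/-!
# Realised histories: THE COUNT ROAD AT THE APEX — per-string hybrid-NE7 data under the prefix from the END of record

Summits-side support leaf of the T⁴-continuum cell (rung (B)+1 on a FINITE torus only; NOT infinite volume, NOT the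
mass gap, NOT the Clay statement; NOT a proof of the spine estimate NE7b).  Row S12 ∕ node A12-I of the claim table
`t4/b2b-balaban-t4-ne7b-p1/LEAVES-NE7b.md` (owner sub-row S12g «APEX», file 2 of 2).

WHAT.  The apex lineage's input for ALL FOUR T⁴ TARGETS is `T4ApexHybrid.HybridNE7Under D (BetaPertHyp D.βfun)`
(`= B16.EndStatementBPrinted D.C → BetaPertHyp D.βfun → ForSmallCouplings D (g₀ ↦ StringwiseHybridNE7 (D.scheme g₀))`;
`T4ApexHybrid.targets_of_hybridNE7Under`, `limit_exists_of_hybridNE7Under`, `limit_unique_of_hybridNE7Under`).  This file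
derives it from the COUNT road's END OF RECORD (pinned form `HistoryRealiseCellsRunPinned.hybridNE7_of_realisedDomainsRun_pinned`,
p218146) and ONE displayed hypothesis: for every tuned run `g₀` and every loop string `os`, a **`CountRoadWitness`** —
the END's term data and H3 ∕ (B)-side ∕ seam binders for the string's dressed partition functions, VERBATIM, with the
observable specialised to the string's product observable `T4GenFunBounds.prodObs (D.scheme g₀) K os` and the (α)
binders sharpened to the E1∕E2 REPRESENTATION identities in Bałaban's normalisation
(`∫ e^{t·obs_K} ρ₀ dU = Σ_{τ ∈ T K} A K t τ`, `ρ₀ = dens K (g₀ K) 0`).  Theorems: **`stringHybridNE7_of_witness`** (one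
string: END ⇒ `∃ K₁, StringHybridNE7 (D.scheme g₀) os l₀ vol K₁`, after rescaling each run's family by the constant
`c_K⁻¹` of `T4StabilitySocket.exists_const_dressedZ` — Bałaban's `ρ₀ = c·e^{−A∕g₀²}` versus the Wilson-normalised
`schemeZ`; `HistoryHybridRescale.hybridNE7_smul`), **`hybridNE7Under_of_countRoad`** (the apex input), and the corollaries
**`limit_exists_of_countRoad`** ∕ **`limit_unique_of_countRoad`** (existence AND uniqueness of the continuum limit of
every joint expectation of unit-scale averaged loop variables, for data with measurable averaging maps, GIVEN (B),
`BetaPertHyp` and the count-road witnesses).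

WHAT THE WITNESS DISPLAYS (nothing of it is discharged here): H3 (`RealisedDomainsR` reading, realised costs below
`costT`, the price sentence over `pshapeTH` under `Dominates C O`, the `Regeneration` numerator readings, both runs), the
E1∕E2 representation identities, the (γ) floors, site budgets, envelopes, the (2.5) size function, NE7c's
`ShellWeightBound`, NE7's `ReindexedBudget` (carrying node U4′'s sizes and the recent-scale rates), four summable rates.
So the honest reading of `hybridNE7Under_of_countRoad` is: **the four T⁴ targets ⇐ (B) ∧ BetaPertHyp ∧ [∀ tuned run,
∀ string: a count-road witness]** — the located new estimates NE7b (H3 + price), NE7c, NE7 (and through its budget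
NE1′–NE5, NE9) sit INSIDE the witness as hypothesis shapes, none in print, none a theorem of the tree.  [folklore]
composition by name; one hypothesis-shape `structure` (types as parameters, no instance attributes), no `[cite:]` tag,
nothing printed asserted.

HONEST.  NE7b NOT proved; spine 0∕9.  HONEST DEPENDENCY (cell): continuum YM on T⁴ ⇐ BetaPertH ∧ nine spine estimates
(0/9 proved); BetaPertH ⇐ (D1) ∧ (D4) ∧ CAP+tail; G-an2-4 gates asym, D1 and NE2/3/4.  This file changes none of it. -/

open Finset MeasureTheory
open Literature.MathematicalPhysics.QuantumFieldTheory.Balaban1983to89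
open Literature.MathematicalPhysics.QuantumFieldTheory.Balaban1983to89.B13ScaleTransfer
open T4PersistenceDictionary T4PersistentHistoryCount T4BankedInduction T4PrintedShapeBanking
open T4WeightBudget T4GlobalDenominator T4LiveClassFibration T4LiveStructureGas T4LiveGasToTerms T4RecordPriceSeam
open T4PartnerMultiplicity T4IndicatorShell T4MatchingAssembly T4MatchingClosure T4MatchingClosureSocket T4Continuum
open T4StabilitySocket T4BranchingRecordsGas T4TaggedShapeBanking T4CanonicalMenus T4RenewalChains
open Summit.QuantumFields.BalabanUV.T4Continuum.PlacementBatch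
open Summit.QuantumFields.BalabanUV.T4Continuum.PlacementSkeleton
open Summit.QuantumFields.BalabanUV.T4Continuum.CountThresholdUniform
open Summit.QuantumFields.BalabanUV.T4Continuum.CountThresholdExit
open Summit.QuantumFields.BalabanUV.T4Continuum.CountSeamJunction
open Summit.QuantumFields.BalabanUV.T4Continuum.LateMergers
open Summit.QuantumFields.BalabanUV.T4Continuum.HistoryFlow
open Summit.QuantumFields.BalabanUV.T4Continuum.HistoryRegeneration
open Summit.QuantumFields.BalabanUV.T4Continuum.HistoryTables
open Summit.QuantumFields.BalabanUV.T4Continuum.HistoryAssemblyTrees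
open Summit.QuantumFields.BalabanUV.T4Continuum.HistoryAssemblyTerms
open Summit.QuantumFields.BalabanUV.T4Continuum.HistoryAssemblyPedigree
open Summit.QuantumFields.BalabanUV.T4Continuum.HistoryConstants
open Summit.QuantumFields.BalabanUV.T4Continuum.HistoryGen
open Summit.QuantumFields.BalabanUV.T4Continuum.ZoneSkeleton
open Summit.QuantumFields.BalabanUV.T4Continuum.HistorySocketTH
open Summit.QuantumFields.BalabanUV.T4Continuum.HistoryCaps
open Summit.QuantumFields.BalabanUV.T4Continuum.HistoryAssemblyPrice
open Summit.QuantumFields.BalabanUV.T4Continuum.HistoryBankingLE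
open Summit.QuantumFields.BalabanUV.T4Continuum.HistoryTreeShapeLE
open Summit.QuantumFields.BalabanUV.T4Continuum.HistoryExitLE
open Summit.QuantumFields.BalabanUV.T4Continuum.HistoryAssemblyTermsLE
open Summit.QuantumFields.BalabanUV.T4Continuum.HistoryRealise
open Summit.QuantumFields.BalabanUV.T4Continuum.HistoryAssemblyRealiseLE
open Summit.QuantumFields.BalabanUV.T4Continuum.HistoryAssemblyRealisePrice
open Summit.QuantumFields.BalabanUV.T4Continuum.HistoryZones
open Summit.QuantumFields.BalabanUV.T4Continuum.HistoryAssemblyRealiseRun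
open Summit.QuantumFields.BalabanUV.T4Continuum.HistoryAssemblyRealiseRunEnd
open Summit.QuantumFields.BalabanUV.T4Continuum.HistoryRealiseCells
open Summit.QuantumFields.BalabanUV.T4Continuum.HistoryRealiseCellsRun
open Summit.QuantumFields.BalabanUV.T4Continuum.HistoryRealiseCellsRunEnd
open Summit.QuantumFields.BalabanUV.T4Continuum.HistoryRealiseCellsRunPinned
open Summit.QuantumFields.BalabanUV.T4Continuum.HistoryHybridRescale

namespace Summit.QuantumFields.BalabanUV.T4Continuum.HistoryRealiseCellsRunApex

noncomputable section

section Apex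

variable {F : T4Family} {G : Type*} [GaugeGroup G] [MeasurableSpace G] [HaarData G] [RegularGaugeGroup G]

/-- **A COUNT-ROAD WITNESS for the tuned run `g₀` and the loop string `os`** (HYPOTHESIS SHAPE — data + the END of
record's displayed binders, NOTHING asserted): the term families of the string's two dressed partition functions (run A
after `K` steps, run B after `K + 1` steps, from `K₀` on, in BAŁABAN's normalisation) with the E1∕E2 representation
identities; the (γ) floors, site budgets and envelopes of the (B) side; the (2.5) size function; H3 — pedigrees REALISED
by the run's own profile with their domains, realised costs, the printed price sentence, the `Regeneration` numerator
readings; NE7c's `ShellWeightBound`; NE7's `ReindexedBudget`; four summable rates; a positive source radius `l₀` and volume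
factor `vol`.  The term index type `ι` and the payload types `α π` (with decidable equality) are PARAMETERS; field names
follow the binders of `HistoryRealiseCellsRunEnd.hybridNE7_of_realisedDomainsRun_printed`. [folklore] -/
structure CountRoadWitness (D : FiniteEpsData F G) (C : T4PrintedShapeBanking.Consts) (O : PrintedO1s) (rr d n : ℕ)
    (g₀ : ℕ → ℝ) (os : List (ULoop F)) (ι α π : Type) [DecidableEq ι] [DecidableEq α] [DecidableEq π] : Type where
  /-- the source radius -/
  l₀ : ℝ
  /-- the volume factor of the matching remainders -/
  vol : ℝ
  /-- the source radius is positive -/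
  l₀_pos : 0 < l₀
  /-- the volume factor is positive -/
  vol_pos : 0 < vol
  /-- the threshold in the number of steps -/
  K₀ : ℕ
  /-- the term families -/
  T : ℕ → Finset ι
  /-- run A's term weights (`K` steps) -/
  A : ℕ → ℝ → ι → ℝ
  /-- run B's term weights (`K + 1` steps) -/
  A' : ℕ → ℝ → ι → ℝ
  /-- the two runs' shell parts (NE7c) -/
  (shA shB : ℕ → ℝ → ι → ℝ)
  /-- the two runs' dead weights (numerator reading) -/
  (dead dead' : ℕ → ℝ → ι → ℝ)
  /-- the two runs' upper normalisation envelopes -/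
  (nup mup : ℕ → ℝ → ℝ)
  /-- the common envelope bound -/
  Nup : ℝ
  /-- NE7 core budget data (`ReindexedBudget`) -/
  (Cc Rr CcRec RrRec : ℕ → ℝ → ι → ℝ)
  /-- NE7 core budget rates; `u s₂ r s` summable -/
  (ν u s₂ q₀ r s : ℕ → ℝ)
  /-- NE7c's shell weight budget -/
  Wsh : ℕ → ℝ
  /-- E1 REPRESENTATION (Bałaban's normalisation): run A's terms sum to the dressed integral of `ρ₀` after `K` steps -/
  reprA : ∀ K t, |t| ≤ l₀ → K₀ ≤ K →
    ∫ U, Real.exp (t * T4GenFunBounds.prodObs (D.scheme g₀) K os U) * D.dens K (g₀ K) 0 U ∂fieldMeasure (F.P K) 0 G =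
      ∑ τ ∈ T K, A K t τ
  /-- E2 REPRESENTATION: run B's terms sum to the dressed integral of `ρ₀` after `K + 1` steps -/
  reprB : ∀ K t, |t| ≤ l₀ → K₀ ≤ K →
    ∫ U, Real.exp (t * T4GenFunBounds.prodObs (D.scheme g₀) (K + 1) os U) * D.dens (K + 1) (g₀ (K + 1)) 0 U
        ∂fieldMeasure (F.P (K + 1)) 0 G = ∑ τ ∈ T K, A' K t τ
  /-- the (γ) small-field mass floor -/
  c₀ : ℝ
  /-- the site budget -/
  n₁ : ℝ
  /-- the floor is positive -/
  c₀_pos : 0 < c₀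
  /-- (γ) floor, run A -/
  floor : ∀ K, K₀ ≤ K → c₀ ≤ smallFieldMass D K (g₀ K)
  /-- (γ) floor, run B -/
  floor' : ∀ K, K₀ ≤ K → c₀ ≤ smallFieldMass D (K + 1) (g₀ (K + 1))
  /-- site budget, run A -/
  sites : ∀ K, K₀ ≤ K → ((D.C ⟨K, F.m, g₀ K⟩).numSites K : ℝ) ≤ n₁
  /-- site budget, run B -/
  sites' : ∀ K, K₀ ≤ K → ((D.C ⟨K + 1, F.m, g₀ (K + 1)⟩).numSites (K + 1) : ℝ) ≤ n₁
  /-- the envelope bound is nonnegative -/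
  Nup_nonneg : 0 ≤ Nup
  /-- envelope, run A -/
  nup_bd : ∀ K t, |t| ≤ l₀ → K₀ ≤ K → 0 ≤ nup K t ∧ nup K t ≤ Nup
  /-- envelope, run B -/
  mup_bd : ∀ K t, |t| ≤ l₀ → K₀ ≤ K → 0 ≤ mup K t ∧ mup K t ≤ Nup
  /-- the size function of (2.5) -/
  R : ℕ → ℕ → ℕ
  /-- (2.5): `R K s` is an admissible size for the running coupling at step `s` -/
  isRj : ∀ K s, s ≤ K → B14.IsRj F.L rr ((D.C ⟨K, F.m, g₀ K⟩).flow.g s) (R K s)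
  /-- sizes are at least one -/
  one_le_R : ∀ K, K₀ ≤ K → ∀ t, 1 ≤ R K t
  /-- H3: the reading map, pedigrees -/
  ped : ℕ → ι → Pedigree α π
  /-- H3: the reading map, root data of the live components -/
  cellP : ℕ → ι → π → Pt d × Finset (Pt d)
  /-- H3: the reading map, live components of each term -/
  liveC : ℕ → ι → Finset α
  /-- H3: the reading map, domains -/
  Zd : ℕ → ι → α → Finset (Pt d)
  /-- H3: the pedigrees are REALISED by the run's own profile with their domains -/
  realised : RealisedDomainsR F.L (runProfile F.L R) n K₀ R T ped cellP liveC Zd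
  /-- H3: realised per-step costs, both runs -/
  (κ κ' : ℕ → (Fin d → ℕ) × Gen (Lab α π) → Gen (Lab α π) → ℕ → ℝ)
  /-- H3: realised costs below the model's booked cost, run A -/
  cost_le : ∀ K, K₀ ≤ K → ∀ τ ∈ badTerms (memOf ped liveC (cellOfR n F.L (runProfile F.L R) ped cellP)) jhalf T K,
    ∀ q ∈ memOf ped liveC (cellOfR n F.L (runProfile F.L R) ped cellP) K τ,
    ∀ m ∈ life (padW (dictWT Prod.fst (R K) C.n₁) 0) q.2, κ K q q.2 m ≤ costT Prod.fst C K (R K) q.2 m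
  /-- H3: realised costs below the model's booked cost, run B -/
  cost_le' : ∀ K, K₀ ≤ K → ∀ τ ∈ badTerms (memOf ped liveC (cellOfR n F.L (runProfile F.L R) ped cellP)) jhalf T K,
    ∀ q ∈ memOf ped liveC (cellOfR n F.L (runProfile F.L R) ped cellP) K τ,
    ∀ m ∈ life (padW (dictWT Prod.fst (R K) C.n₁) 0) q.2, κ' K q q.2 m ≤ costT Prod.fst C K (R K) q.2 m
  /-- H3: class price ∕ resummation factors, both runs -/
  (Fc Rf Fc' Rf' : ℕ → Finset (BSlot (Fin d → ℕ) PEv) → ℝ)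
  /-- H3: the per-term price sentence in print's currency, run A -/
  price : ∀ K t, |t| ≤ l₀ → K₀ ≤ K →
    ∀ τ ∈ badTerms (memOf ped liveC (cellOfR n F.L (runProfile F.L R) ped cellP)) jhalf T K,
    Fc K (bstrOf Prod.fst (memOf ped liveC (cellOfR n F.L (runProfile F.L R) ped cellP)) K τ) *
        Rf K (bstrOf Prod.fst (memOf ped liveC (cellOfR n F.L (runProfile F.L R) ped cellP)) K τ) ≤
      ∏ q ∈ memOf ped liveC (cellOfR n F.L (runProfile F.L R) ped cellP) K τ,
        pshapeTH Prod.fst O C 1 ((F.L : ℝ) ^ d) (R K) (D.C ⟨K, F.m, g₀ K⟩).flow.g 0 (κ K q) q.2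
  /-- H3: the per-term price sentence in print's currency, run B -/
  price' : ∀ K t, |t| ≤ l₀ → K₀ ≤ K →
    ∀ τ ∈ badTerms (memOf ped liveC (cellOfR n F.L (runProfile F.L R) ped cellP)) jhalf T K,
    Fc' K (bstrOf Prod.fst (memOf ped liveC (cellOfR n F.L (runProfile F.L R) ped cellP)) K τ) *
        Rf' K (bstrOf Prod.fst (memOf ped liveC (cellOfR n F.L (runProfile F.L R) ped cellP)) K τ) ≤
      ∏ q ∈ memOf ped liveC (cellOfR n F.L (runProfile F.L R) ped cellP) K τ,
        pshapeTH Prod.fst O C 1 ((F.L : ℝ) ^ d) (R K) (D.C ⟨K, F.m, g₀ K⟩).flow.g 0 (κ' K q) q.2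
  /-- H3 numerator reading, run A: terms below dead weight × class factor × envelope -/
  up : ∀ K t, |t| ≤ l₀ → K₀ ≤ K →
    ∀ c ∈ badClasses Prod.fst (memOf ped liveC (cellOfR n F.L (runProfile F.L R) ped cellP)) jhalf T K,
    ∀ τ ∈ fibre (bstrOf Prod.fst (memOf ped liveC (cellOfR n F.L (runProfile F.L R) ped cellP))) T K c,
      A K t τ ≤ dead K t τ * Fc K c * nup K t
  /-- H3 numerator reading, run A: dead weights nonnegative -/
  dead_nonneg : ∀ K t, |t| ≤ l₀ → K₀ ≤ K →
    ∀ c ∈ badClasses Prod.fst (memOf ped liveC (cellOfR n F.L (runProfile F.L R) ped cellP)) jhalf T K,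
    ∀ τ ∈ fibre (bstrOf Prod.fst (memOf ped liveC (cellOfR n F.L (runProfile F.L R) ped cellP))) T K c,
      0 ≤ dead K t τ
  /-- H3 numerator reading, run A: the resummation over the class (the placement sum) -/
  resum : ∀ K t, |t| ≤ l₀ → K₀ ≤ K →
    ∀ c ∈ badClasses Prod.fst (memOf ped liveC (cellOfR n F.L (runProfile F.L R) ped cellP)) jhalf T K,
    ∑ τ ∈ fibre (bstrOf Prod.fst (memOf ped liveC (cellOfR n F.L (runProfile F.L R) ped cellP))) T K c,
      dead K t τ ≤ Rf K c
  /-- H3 numerator reading, run A: class factors nonnegative -/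
  F_nonneg : ∀ K t, |t| ≤ l₀ → K₀ ≤ K →
    ∀ c ∈ badClasses Prod.fst (memOf ped liveC (cellOfR n F.L (runProfile F.L R) ped cellP)) jhalf T K, 0 ≤ Fc K c
  /-- H3 numerator reading, run B -/
  up' : ∀ K t, |t| ≤ l₀ → K₀ ≤ K →
    ∀ c ∈ badClasses Prod.fst (memOf ped liveC (cellOfR n F.L (runProfile F.L R) ped cellP)) jhalf T K,
    ∀ τ ∈ fibre (bstrOf Prod.fst (memOf ped liveC (cellOfR n F.L (runProfile F.L R) ped cellP))) T K c,
      A' K t τ ≤ dead' K t τ * Fc' K c * mup K t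
  /-- H3 numerator reading, run B -/
  dead'_nonneg : ∀ K t, |t| ≤ l₀ → K₀ ≤ K →
    ∀ c ∈ badClasses Prod.fst (memOf ped liveC (cellOfR n F.L (runProfile F.L R) ped cellP)) jhalf T K,
    ∀ τ ∈ fibre (bstrOf Prod.fst (memOf ped liveC (cellOfR n F.L (runProfile F.L R) ped cellP))) T K c,
      0 ≤ dead' K t τ
  /-- H3 numerator reading, run B -/
  resum' : ∀ K t, |t| ≤ l₀ → K₀ ≤ K →
    ∀ c ∈ badClasses Prod.fst (memOf ped liveC (cellOfR n F.L (runProfile F.L R) ped cellP)) jhalf T K,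
    ∑ τ ∈ fibre (bstrOf Prod.fst (memOf ped liveC (cellOfR n F.L (runProfile F.L R) ped cellP))) T K c,
      dead' K t τ ≤ Rf' K c
  /-- H3 numerator reading, run B -/
  F'_nonneg : ∀ K t, |t| ≤ l₀ → K₀ ≤ K →
    ∀ c ∈ badClasses Prod.fst (memOf ped liveC (cellOfR n F.L (runProfile F.L R) ped cellP)) jhalf T K, 0 ≤ Fc' K c
  /-- NE7c: the indicator shells' relative weight bound -/
  shell : ShellWeightBound l₀ T A A' shA shB Wsh
  /-- NE7: the core budget on the hybrid cores over the bad classes -/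
  budget : ReindexedBudget l₀ vol T (fun K t τ => A K t τ - shA K t τ) (fun K t τ => A' K t τ - shB K t τ)
    (badOfClass (bstrOf Prod.fst (memOf ped liveC (cellOfR n F.L (runProfile F.L R) ped cellP))) T
      (fun K _ => badClasses Prod.fst (memOf ped liveC (cellOfR n F.L (runProfile F.L R) ped cellP)) jhalf T K))
    Cc Rr CcRec RrRec ν u s₂ q₀ r s
  /-- summable rates -/
  sum_r : Summable r
  /-- summable rates -/
  sum_u : Summable u
  /-- summable rates -/
  sum_s : Summable s
  /-- summable rates -/
  sum_s₂ : Summable s₂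

omit [RegularGaugeGroup G] in
/-- The E1∕E2 representation in Bałaban's normalisation relates to the apex's Wilson-normalised dressed partition
function by the run's constant: `Σ_T A K t = c_K · schemeZ (D.scheme g₀) os K t`, `c_K > 0`
(`T4StabilitySocket.exists_const_dressedZ`). [folklore] -/
theorem exists_const_schemeZ (D : FiniteEpsData F G) (g₀ : ℕ → ℝ) (os : List (ULoop F)) (K : ℕ) :
    ∃ c : ℝ, 0 < c ∧ ∀ t : ℝ,
      ∫ U, Real.exp (t * T4GenFunBounds.prodObs (D.scheme g₀) K os U) * D.dens K (g₀ K) 0 U ∂fieldMeasure (F.P K) 0 G =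
        c * T4GenFunBounds.schemeZ (D.scheme g₀) os K t := by
  obtain ⟨c, hc, -, h⟩ := exists_const_dressedZ D K (g₀ K)
  exact ⟨c, hc, fun t => h _ t⟩

omit [RegularGaugeGroup G] in
/-- **ONE STRING: THE COUNT ROAD'S END ⇒ THE APEX'S PER-STRING HYBRID-NE7 DATUM**, at a run tuned within `]0, γ]` to `g`
below the thresholds of the pinned END: the END of record (`hybridNE7_of_realisedDomainsRun_pinned`'s inner function, all
its binders read off the witness; the (α) bounds are the E1∕E2 identities) gives `HybridNE7` for the shifted families in
Bałaban's normalisation; rescaling run A by `c_K⁻¹` and run B by `c_{K+1}⁻¹` (`exists_const_schemeZ`,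
`HistoryHybridRescale.hybridNE7_smul`) turns the E1∕E2 identities into the Wilson-normalised dictionary of
`StringHybridNE7`. [folklore] -/
theorem stringHybridNE7_of_hybridNE7 (D : FiniteEpsData F G) {C : T4PrintedShapeBanking.Consts} {O : PrintedO1s}
    {rr d n : ℕ} {g₀ : ℕ → ℝ} {os : List (ULoop F)} {ι α π : Type} [DecidableEq ι] [DecidableEq α] [DecidableEq π]
    (X : CountRoadWitness D C O rr d n g₀ os ι α π) {Bad : ℕ → ℝ → Finset ι} {W δ : ℕ → ℝ} {K₁ K₂ : ℕ}
    (hK : X.K₀ ≤ K₁)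
    (hH : HybridNE7 X.l₀ X.vol (fun K => X.T (K₁ + (K₂ + K))) (fun K => X.A (K₁ + (K₂ + K)))
      (fun K => X.A' (K₁ + (K₂ + K))) Bad W (fun K => X.shA (K₁ + (K₂ + K))) (fun K => X.shB (K₁ + (K₂ + K)))
      (fun K => X.Wsh (K₁ + (K₂ + K))) δ) :
    StringHybridNE7 (D.scheme g₀) os X.l₀ X.vol (K₁ + K₂) := by
  -- the two runs' normalisation constants, cutoff by cutoff
  have hcA : ∀ K, ∃ c : ℝ, 0 < c ∧ ∀ t : ℝ,
      ∫ U, Real.exp (t * T4GenFunBounds.prodObs (D.scheme g₀) K os U) * D.dens K (g₀ K) 0 U ∂fieldMeasure (F.P K) 0 G =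
        c * T4GenFunBounds.schemeZ (D.scheme g₀) os K t := fun K => exists_const_schemeZ D g₀ os K
  choose c hc hcZ using hcA
  have hzp : ∀ K, 0 < (c (K₁ + (K₂ + K)))⁻¹ := fun K => inv_pos.2 (hc _)
  have hz'p : ∀ K, 0 < (c (K₁ + (K₂ + K) + 1))⁻¹ := fun K => inv_pos.2 (hc _)
  have hH' := hybridNE7_smul (z := fun K => (c (K₁ + (K₂ + K)))⁻¹) (z' := fun K => (c (K₁ + (K₂ + K) + 1))⁻¹)
    hzp hz'p hH
  refine ⟨ι, inferInstance, fun K => X.T (K₁ + (K₂ + K)), fun K t τ => (c (K₁ + (K₂ + K)))⁻¹ * X.A (K₁ + (K₂ + K)) t τ,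
    fun K t τ => (c (K₁ + (K₂ + K) + 1))⁻¹ * X.A' (K₁ + (K₂ + K)) t τ,
    fun K t τ => (c (K₁ + (K₂ + K)))⁻¹ * X.shA (K₁ + (K₂ + K)) t τ,
    fun K t τ => (c (K₁ + (K₂ + K) + 1))⁻¹ * X.shB (K₁ + (K₂ + K)) t τ, Bad, W, fun K => X.Wsh (K₁ + (K₂ + K)), δ, hH',
    ?_, ?_⟩
  · intro K t ht
    have hKK : X.K₀ ≤ K₁ + (K₂ + K) := hK.trans (Nat.le_add_right _ _)
    have h1 := X.reprA (K₁ + (K₂ + K)) t ht hKK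
    have h2 := hcZ (K₁ + (K₂ + K)) t
    have hcp := hc (K₁ + (K₂ + K))
    rw [show K₁ + K₂ + K = K₁ + (K₂ + K) from Nat.add_assoc _ _ _, ← mul_sum, ← h1, h2, ← mul_assoc,
      inv_mul_cancel₀ hcp.ne', one_mul]
  · intro K t ht
    have hKK : X.K₀ ≤ K₁ + (K₂ + K) := hK.trans (Nat.le_add_right _ _)
    have h1 := X.reprB (K₁ + (K₂ + K)) t ht hKK
    have h2 := hcZ (K₁ + (K₂ + K) + 1) t
    have hcp := hc (K₁ + (K₂ + K) + 1)
    rw [show K₁ + K₂ + K + 1 = K₁ + (K₂ + K) + 1 by omega, ← mul_sum, ← h1, h2, ← mul_assoc,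
      inv_mul_cancel₀ hcp.ne', one_mul]

end Apex

section Under

variable {F : T4Family} {G : Type*} [GaugeGroup G] [MeasurableSpace G] [HaarData G] [RegularGaugeGroup G]

/-- **ROW NE7b AT THE APEX: THE COUNT ROAD'S END ⇒ `HybridNE7Under D (BetaPertHyp D.βfun)`.**  For data with measurable
averaging maps, the datum's sign conventions and the constants' side conditions: if every tuned run `g₀` and every loop
string `os` carry a `CountRoadWitness` (H3 + representation + (B)-side data + NE7c + NE7 + rates — DISPLAYED, none in
print, none a theorem of the tree), then the apex input holds — its antecedents `(B) = B16.EndStatementBPrinted D.C` and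
`BetaPertHyp D.βfun` are consumed BY NAME by the pinned END for the thresholds `γ₁`, `g₁`.  Honest reading: the four T⁴
targets (`T4ApexHybrid.targets_of_hybridNE7Under`) ⇐ (B) ∧ BetaPertHyp ∧ [∀ tuned run ∀ string, a count-road witness].
NE7b NOT proved. [folklore] -/
theorem hybridNE7Under_of_countRoad (D : FiniteEpsData F G) (hM : D.AvgMeasurable) (hsign : B16.SignConventions D.C)
    {C : T4PrintedShapeBanking.Consts} {O : PrintedO1s} (hD : Dominates C O)
    {rr : ℕ} {β₀ : ℝ} (h : ThresholdOK C F.L rr β₀) (hμ : 0 < C.μ) (d n : ℕ)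
    (hκ₁ : (d : ℝ) * Real.log F.L + 2 * Real.log 2 ≤ C.κ₁) (hE₀ : Real.log (2 + birthMass C) ≤ C.E₀)
    (hβ₀ : 0 < β₀) (hLβ : (F.L : ℝ) * β₀ ≤ 1) (hn₁ : 13 ≤ C.n₁) (hn : 0 < n)
    (hData : ∀ (γ g : ℝ) (g₀ : ℕ → ℝ), 0 < γ → 0 < g → D.Tuned γ g g₀ →
      ∀ os : List (ULoop F), ∃ (ι α π : Type) (_ : DecidableEq ι) (_ : DecidableEq α) (_ : DecidableEq π),
        Nonempty (CountRoadWitness D C O rr d n g₀ os ι α π)) :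
    T4ApexHybrid.HybridNE7Under D (BetaPertHyp D.βfun) := by
  intro hB hβ
  obtain ⟨γ₁, hγ₁, H⟩ := hybridNE7_of_realisedDomainsRun_pinned D hB hβ hsign hD h hμ d n hκ₁ hE₀ hβ₀ hLβ
    hn₁ hn
  refine ⟨γ₁, hγ₁, fun γ hγ hγle => ?_⟩
  obtain ⟨g₁, hg₁, Hg⟩ := H γ hγ hγle
  refine ⟨g₁, hg₁, fun g hg hgle g₀ ht os => ?_⟩
  obtain ⟨Em, -, HE⟩ := Hg g hg hgle
  obtain ⟨ι, α, π, _, _, _, ⟨X⟩⟩ := hData γ g g₀ hγ hg ht os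
  have hm : ∀ K o, Measurable ((D.scheme g₀).obs K o) := fun K o => D.measurable_avgObs hM K o
  have h1 : ∀ K o U, |(D.scheme g₀).obs K o U| ≤ 1 := fun K o U => D.abs_avgObs_le_one K o U
  obtain ⟨K₁, K₂, hK₁, hH⟩ := HE g₀ ht X.l₀ X.vol X.K₀ X.T X.A X.A' X.shA X.shB X.dead X.dead' X.nup X.mup X.Nup
    X.Cc X.Rr X.CcRec X.RrRec X.ν X.u X.s₂ X.q₀ X.r X.s X.Wsh (fun K => T4GenFunBounds.prodObs (D.scheme g₀) K os) 1
    (fun K => T4GenFunBounds.measurable_prodObs (D.scheme g₀) hm K os)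
    (fun K U => T4GenFunBounds.abs_prodObs_le_one (D.scheme g₀) h1 K os U)
    (fun K t ht hK => (X.reprA K t ht hK).le) (fun K t ht hK => (X.reprB K t ht hK).le) X.c₀ X.n₁ X.c₀_pos X.floor
    X.floor' X.sites X.sites' X.Nup_nonneg X.nup_bd X.mup_bd X.R X.isRj X.one_le_R X.ped X.cellP X.liveC X.Zd X.realised
    X.κ X.κ' X.cost_le X.cost_le' X.Fc X.Rf X.Fc' X.Rf' X.price X.price' X.up X.dead_nonneg X.resum X.F_nonneg X.up'
    X.dead'_nonneg X.resum' X.F'_nonneg X.shell X.budget X.sum_r X.sum_u X.sum_s X.sum_s₂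
  exact ⟨X.l₀, X.vol, K₁ + K₂, X.l₀_pos, X.vol_pos, stringHybridNE7_of_hybridNE7 D X hK₁ hH⟩

/-- **COROLLARY: EXISTENCE** of the continuum limit of every joint expectation of unit-scale averaged loop variables along
the full sequence of spacings, under the prefix (`D.ym4_torus_continuum_limit_exists`), GIVEN the count-road witnesses —
by `T4ApexHybrid.limit_exists_of_hybridNE7Under`.  CONDITIONAL; NE7b NOT proved. [folklore] -/
theorem limit_exists_of_countRoad (D : FiniteEpsData F G) (hM : D.AvgMeasurable) (hsign : B16.SignConventions D.C)
    {C : T4PrintedShapeBanking.Consts} {O : PrintedO1s} (hD : Dominates C O)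
    {rr : ℕ} {β₀ : ℝ} (h : ThresholdOK C F.L rr β₀) (hμ : 0 < C.μ) (d n : ℕ)
    (hκ₁ : (d : ℝ) * Real.log F.L + 2 * Real.log 2 ≤ C.κ₁) (hE₀ : Real.log (2 + birthMass C) ≤ C.E₀)
    (hβ₀ : 0 < β₀) (hLβ : (F.L : ℝ) * β₀ ≤ 1) (hn₁ : 13 ≤ C.n₁) (hn : 0 < n)
    (hData : ∀ (γ g : ℝ) (g₀ : ℕ → ℝ), 0 < γ → 0 < g → D.Tuned γ g g₀ →
      ∀ os : List (ULoop F), ∃ (ι α π : Type) (_ : DecidableEq ι) (_ : DecidableEq α) (_ : DecidableEq π),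
        Nonempty (CountRoadWitness D C O rr d n g₀ os ι α π)) :
    D.ym4_torus_continuum_limit_exists :=
  T4ApexHybrid.limit_exists_of_hybridNE7Under D hM
    (hybridNE7Under_of_countRoad D hM hsign hD h hμ d n hκ₁ hE₀ hβ₀ hLβ hn₁ hn hData)

/-- **COROLLARY: UNIQUENESS** of the limit points (`D.ym4_torus_continuum_limit_unique`) under the same displayed data —
by `T4ApexHybrid.limit_unique_of_hybridNE7Under`.  CONDITIONAL; NE7b NOT proved. [folklore] -/
theorem limit_unique_of_countRoad (D : FiniteEpsData F G) (hM : D.AvgMeasurable) (hsign : B16.SignConventions D.C)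
    {C : T4PrintedShapeBanking.Consts} {O : PrintedO1s} (hD : Dominates C O)
    {rr : ℕ} {β₀ : ℝ} (h : ThresholdOK C F.L rr β₀) (hμ : 0 < C.μ) (d n : ℕ)
    (hκ₁ : (d : ℝ) * Real.log F.L + 2 * Real.log 2 ≤ C.κ₁) (hE₀ : Real.log (2 + birthMass C) ≤ C.E₀)
    (hβ₀ : 0 < β₀) (hLβ : (F.L : ℝ) * β₀ ≤ 1) (hn₁ : 13 ≤ C.n₁) (hn : 0 < n)
    (hData : ∀ (γ g : ℝ) (g₀ : ℕ → ℝ), 0 < γ → 0 < g → D.Tuned γ g g₀ →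
      ∀ os : List (ULoop F), ∃ (ι α π : Type) (_ : DecidableEq ι) (_ : DecidableEq α) (_ : DecidableEq π),
        Nonempty (CountRoadWitness D C O rr d n g₀ os ι α π)) :
    D.ym4_torus_continuum_limit_unique :=
  T4ApexHybrid.limit_unique_of_hybridNE7Under D hM
    (hybridNE7Under_of_countRoad D hM hsign hD h hμ d n hκ₁ hE₀ hβ₀ hLβ hn₁ hn hData)

end Under

end

end Summit.QuantumFields.BalabanUV.T4Continuum.HistoryRealiseCellsRunApex
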